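import Literature.AlgebraicGeometry.Resolution.InseparableLocalUniformization
import Mathlib.RingTheory.Localization.FractionRing
import HarnessLib

/-!
# Regular chart from Temkin's inseparable local uniformization
# (crux `IndSmooth.ValuativeSmoothing`, line `birth`, reshape r2, stub `stub_temkinRegularChart`)

Stub `stub_temkinRegularChart` of the skeleton for crux stmt-ResolutionOfSingularities-16087
(lead reshape r2). CONDITIONAL on the tree's named fact
`Literature.AlgebraicGeometry.Resolution.Temkin2013Relative` (Temkin 2013, Thm. 1.3.2, relative
form; taken as the explicit hypothesis `hT`), it repackages Temkin's conclusion as REGULAR CHART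
DATA for an arbitrary finitely generated `k`-subalgebra `R` of a valuation ring `O ⊇ k` of a
finitely generated field `K/k`: a finite purely inseparable `L ⊇ K`, the valuation ring `O'` of
`L` over `O`, and a finitely generated `k`-subalgebra `N ⊆ O'` of `L` containing the image of `R`
whose localisation at the centre `𝔪_{O'} ∩ N` is a regular local ring.

Proof: `R` need not be an affine model of `O` (`Frac R` may be smaller than `K`), so first
enlarge it to one (`exists_affineModel_ge`: join `R` with any affine model from
`exists_affineModel`); apply `Temkin2013Relative` to this model `A`; of its conclusion keep `L`,
`O'` and the `L`-normalisation `N` of the refinement `A' ≥ A`, viewed as a `k`-subalgebra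
(`N.restrictScalars k`, same underlying subring, same centre). The image of `R ≤ A ≤ A'` lies in
`N` because an element of `A'.map (K → L)` is integral over that subalgebra.
-/

-- single-problem summit: the doubled namespace component is forced
set_option linter.dupNamespace false

namespace Summit.ResolutionOfSingularities.ResolutionOfSingularities.Theorems.ValuativeSmoothing

open Literature.AlgebraicGeometry.Resolution

/-- **Affine models refining a finitely generated subalgebra.** For a finitely generated field
extension `K/k`, a valuation ring `O ⊇ k` of `K` and a finitely generated `k`-subalgebra
`R ⊆ O`, there is a finitely generated `k`-subalgebra `A` with `R ≤ A ⊆ O` and `Frac A = K`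
(join `R` with any affine model of `O`; a subalgebra containing an affine model is one).
[folklore] -/
theorem exists_affineModel_ge (k K : Type) [Field k] [Field K] [Algebra k K]
    (hK : (⊤ : IntermediateField k K).FG) (O : ValuationSubring K)
    (hO : ∀ c : k, algebraMap k K c ∈ O)
    (R : Subalgebra k K) (hR : R.FG) (hRO : R.toSubring ≤ O.toSubring) :
    ∃ A : Subalgebra k K, R ≤ A ∧ A.toSubring ≤ O.toSubring ∧ A.FG ∧ IsFractionRing A K := by
  obtain ⟨A, hAO, hAfg, hAfr⟩ := exists_affineModel k K hK O hO
  -- `O` as a `k`-subalgebra of `K`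
  let Oalg : Subalgebra k K := { O.toSubring with algebraMap_mem' := hO }
  have hRO' : R ≤ Oalg := fun x hx => hRO hx
  have hAO' : A ≤ Oalg := fun x hx => hAO hx
  have hle : R ⊔ A ≤ Oalg := sup_le hRO' hAO'
  refine ⟨R ⊔ A, le_sup_left, fun x hx => hle hx, hR.sup hAfg, ?_⟩
  -- every `z : K` is a quotient of elements of `A ≤ R ⊔ A`
  refine IsFractionRing.of_field (↥(R ⊔ A)) K fun z => ?_
  obtain ⟨a, b, -, rfl⟩ := IsFractionRing.div_surjective (A := A) z
  exact ⟨⟨a, (le_sup_right : A ≤ R ⊔ A) a.2⟩, ⟨b, (le_sup_right : A ≤ R ⊔ A) b.2⟩, rfl⟩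

/-- **Stub `stub_temkinRegularChart` (line `birth`, reshape r2, crux
`IndSmooth.ValuativeSmoothing`).** Conditional on Temkin's inseparable local uniformization in
its relative form (`Temkin2013Relative`, hypothesis `hT`): for a finitely generated field
extension `K/k`, a valuation ring `O ⊇ k` of `K` and a finitely generated `k`-subalgebra `R ⊆ O`,
there are a finite purely inseparable extension `L/K`, a valuation ring `O'` of `L` with
`O' ∩ K = O`, and a finitely generated `k`-subalgebra `N ⊆ O'` of `L` containing the image of `R`
such that the localisation of `N` at the centre `𝔪_{O'} ∩ N` is a regular local ring. (Enlarge
`R` to an affine model `A` of `O`, apply the theorem to `(k, K, O, A)`, and return the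
`L`-normalisation of the refined model `A' ≥ A` with scalars restricted to `k`; it contains the
image of `R ≤ A ≤ A'`, every element of a ring being integral over it.)
[cite: Temkin2013, Thm. 1.3.2] -/
theorem stub_temkinRegularChart
    (hT : Literature.AlgebraicGeometry.Resolution.Temkin2013Relative.{0})
    (k K : Type) [Field k] [Field K] [Algebra k K]
    (hK : (⊤ : IntermediateField k K).FG) (O : ValuationSubring K)
    (hO : ∀ c : k, algebraMap k K c ∈ O)
    (R : Subalgebra k K) (hR : R.FG) (hRO : R.toSubring ≤ O.toSubring) :
    ∃ (L : Type) (_ : Field L) (_ : Algebra K L) (_ : Algebra k L) (_ : IsScalarTower k K L),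
      FiniteDimensional K L ∧ IsPurelyInseparable K L ∧
      ∃ O' : ValuationSubring L, O'.comap (algebraMap K L) = O ∧
      ∃ (N : Subalgebra k L) (hN : N.toSubring ≤ O'.toSubring), N.FG ∧
        (∀ r : K, r ∈ R → algebraMap K L r ∈ N) ∧
        IsRegularLocalRing (Localization.AtPrime
          (Ideal.comap (Subring.inclusion hN) (IsLocalRing.maximalIdeal O'))) := by
  obtain ⟨A, hRA, hAO, hAfg, hAfr⟩ := exists_affineModel_ge k K hK O hO R hR hRO
  obtain ⟨L, iF, iA, iA', iT, hfin, hpi, l, -, -, A', hAA', -, -, -, O', hO', N, hN, hNint, hNfg,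
    -, -, -, hreg⟩ := hT k K hK O hO A hAO hAfg hAfr
  refine ⟨L, iF, iA, iA', iT, hfin, hpi, O', hO', N.restrictScalars k, hN, hNfg, ?_, hreg⟩
  -- the image of `R ≤ A ≤ A'` lies in `N = Nr_L(A')`
  intro r hr
  have hr' : IsScalarTower.toAlgHom k K L r ∈ A'.map (IsScalarTower.toAlgHom k K L) :=
    Subalgebra.mem_map.mpr ⟨r, hAA' (hRA hr), rfl⟩
  have hmem : algebraMap K L r ∈ (N : Set L) := by
    rw [hNint]
    exact isIntegral_algebraMap (R := ↥(A'.map (IsScalarTower.toAlgHom k K L))) (x := ⟨_, hr'⟩)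
  exact hmem

end Summit.ResolutionOfSingularities.ResolutionOfSingularities.Theorems.ValuativeSmoothing
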